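import Summits.HodgeConjecture.CorCM.Census.CentralSquaresCompanion
import Summits.HodgeConjecture.CorCM.Census.CentralSquaresPartnersTransversal

/-!
# The square-central class, LII: swapped transversals and the companion frame in a MULTI-PARTNER base block

COR-CM (cell `pub-hodgecm2`), count-neutral kernel combinatorics by the binder seat b09 (gen 50; lane SQUARE-CENTRAL CLASS, part LII), on part LI
(`Census/CentralSquaresPartnersTransversal.lean`: `rel_transversal_mem_partners`), part VII (`Census/CentralSquaresCompanion.lean`: `transversal_swap`,
`companion_card`, `companion_rt`, `companion_sq`, `companion_swap`, `or_companion_iff`) and parts II–III (`dev_compl`, `oflipCM_rt_self`), all BY NAME.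
Theorems only: no definition, no `decide`, no certificate, no named fact, no `sorry`.  HONEST FRAMING: `HC_CM` is NOT proved, here or anywhere in the tree;
nothing here is a period or a headline.

THE SETTING of part LI: a multi-partner base block (`hbase`: base changes = `T₀`, `T̄₀`, partners `T' ∈ 𝒯`, complements; `|T₀| = 4m`, `|T₀ ∖ T'| = 2m`,
partners pairwise at distance `2m`), a DIHEDRAL-TYPE partner `T₁ ∈ 𝒯` with swap `Q` (`T₀·Q⁻¹ = T₁`, `Q² = 1`, place permutation preserving `𝓗 = T₀ ∖ T₁`),
a base-change stable lattice `L` holding a strict lowering cover of `T₀`, and the TIE HYPOTHESES: at the types whose deviation set is a transversal of the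
swap inside `𝓗` (resp. inside `T₀ ∩ T₁`) the only base changes at distance `m` are `T₀` and `T₁` (resp. `T₀` and `T̄₁`) — `hties`, `htiesC` (in the affine
rank-two blocks: transversals meeting every other partnerʼs `𝓗'` in `1 … m−1` places).

* §1 `Y_sub_Y_mem_partners` (`m ≥ 2`): `Y_s − Y_{σs} ∈ L` for `s` in a transversal `T ⊆ 𝓗` — the difference `R(T) − R(T')` of part LIʼs relations for
  `T` and the swapped transversal `T' = (T ∖ s) ∪ {σs}`.
* §2 THE COMPANION FRAME `(T₀; T̄₁, cQ)` is again a multi-partner frame: partners `insert T̄₁ (𝒯.erase T₁)` (`companion_base_partners`,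
  `companion_card_partners`, `companion_pair_partners`).
* §3 `relc_mem_partners` (`Rᶜ(T') ∈ L`, `m ≥ 2`, pairs in `L`) and `Y'_sub_Y'_mem_partners` (`Y'_a − Y'_{σa} ∈ L`): part LI and §1 run in the companion
  frame, modulo pairs.
With part LI this gives, at every dihedral-type partner of a multi-partner block, the relation kinds `R`, `Rᶜ`, `Y − Y`, `Y' − Y'` of the four-type theory;
the pair relations (`Y' + Y'`, `Y + Y`, hence `2Y`, `2Y'`, level `m + 2`, `m ≥ 3`) are the successorʼs part.

## References
* [Pohlmann1968] H. Pohlmann, Algebraic cycles on abelian varieties of complex multiplication type, Ann. of Math. 88 (1968), Thm 1.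
-/

namespace Summit.HodgeConjecture.CorCM.Census.CentralSquares

open Finset
open scoped symmDiff
open Summit.HodgeConjecture.CorCM.Prior.AllgGroup.RfwfAllgGroup
open Summit.HodgeConjecture.CorCM.Census.BlockParity
open Summit.HodgeConjecture.CorCM.Census.Coinvariant
open Summit.HodgeConjecture.CorCM.Census.TwistGeneration
open Summit.HodgeConjecture.CorCM.Census.BaseBlock
open Summit.HodgeConjecture.CorCM.Census.CoverClosure

noncomputable section

variable {G : Type*} [Group G] [Fintype G] [DecidableEq G] (c : G)

/-! ## §2 (lemmas) The companion partner set -/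

/-- **The base block with `T̄₁` as a partner**: partners `insert T̄₁ (𝒯.erase T₁)`. [folklore] -/
theorem companion_base_partners (hc2 : c * c = 1) {T₀ : CMF G c} {𝒯 : Finset (CMF G c)}
    (hbase : ∀ Q : G, rt c Q T₀ = T₀ ∨ rt c Q T₀ = rt c c T₀ ∨ ∃ T₁ ∈ 𝒯, rt c Q T₀ = T₁ ∨ rt c Q T₀ = rt c c T₁)
    {T₁ : CMF G c} :
    ∀ Q' : G, rt c Q' T₀ = T₀ ∨ rt c Q' T₀ = rt c c T₀ ∨
      ∃ T₂ ∈ insert (rt c c T₁) (𝒯.erase T₁), rt c Q' T₀ = T₂ ∨ rt c Q' T₀ = rt c c T₂ := by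
  classical
  intro Q'
  have e : rt c c (rt c c T₁) = T₁ := by rw [← rt_mul, hc2, rt_one]
  rcases hbase Q' with h | h | ⟨T₂, hT₂, h | h⟩
  · exact Or.inl h
  · exact Or.inr (Or.inl h)
  · by_cases h12 : T₂ = T₁
    · subst h12; exact Or.inr (Or.inr ⟨rt c c T₂, mem_insert_self _ _, Or.inr (by rw [e]; exact h)⟩)
    · exact Or.inr (Or.inr ⟨T₂, mem_insert_of_mem (mem_erase.mpr ⟨h12, hT₂⟩), Or.inl h⟩)
  · by_cases h12 : T₂ = T₁
    · subst h12; exact Or.inr (Or.inr ⟨rt c c T₂, mem_insert_self _ _, Or.inl h⟩)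
    · exact Or.inr (Or.inr ⟨T₂, mem_insert_of_mem (mem_erase.mpr ⟨h12, hT₂⟩), Or.inr h⟩)

/-- **Partner distances with `T̄₁` as a partner**: `|T₀ ∖ T| = 2m` on `insert T̄₁ (𝒯.erase T₁)`. [folklore] -/
theorem companion_card_partners (hcen : ∀ x : G, x * c = c * x) (T₀ : CMF G c) (𝒯 : Finset (CMF G c)) (m : ℕ) (hn : T₀.1.card = 4 * m)
    (hH : ∀ T₁ ∈ 𝒯, (T₀.1 \ T₁.1).card = 2 * m) {T₁ : CMF G c} (hT₁ : T₁ ∈ 𝒯) :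
    ∀ T ∈ insert (rt c c T₁) (𝒯.erase T₁), (T₀.1 \ T.1).card = 2 * m := by
  classical
  intro T hT
  rcases mem_insert.mp hT with rfl | hT'
  · exact companion_card c hcen T₀ T₁ m hn (hH T₁ hT₁)
  · exact hH T (mem_of_mem_erase hT')

omit [Group G] [Fintype G] in
/-- `(T₀ ∖ 𝓗₁) ∆ 𝓗₂ = T₀ ∖ (𝓗₁ ∆ 𝓗₂)` for `𝓗₁, 𝓗₂ ⊆ T₀`. [folklore] -/
theorem sdiff_symmDiff_eq (T₀ H₁ H₂ : Finset G) (h₁ : H₁ ⊆ T₀) (h₂ : H₂ ⊆ T₀) : (T₀ \ H₁) ∆ H₂ = T₀ \ (H₁ ∆ H₂) := by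
  ext t
  simp only [mem_symmDiff, mem_sdiff, not_and, not_not]
  have h1 := @h₁ t
  have h2 := @h₂ t
  tauto

/-- **Pairwise partner distances with `T̄₁` as a partner.** [folklore] -/
theorem companion_pair_partners (hcen : ∀ x : G, x * c = c * x) (T₀ : CMF G c) (𝒯 : Finset (CMF G c)) (m : ℕ) (hn : T₀.1.card = 4 * m)
    (hpair : ∀ T₁ ∈ 𝒯, ∀ T₂ ∈ 𝒯, T₁ ≠ T₂ → ((T₀.1 \ T₁.1) ∆ (T₀.1 \ T₂.1)).card = 2 * m) {T₁ : CMF G c} (hT₁ : T₁ ∈ 𝒯) :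
    ∀ T ∈ insert (rt c c T₁) (𝒯.erase T₁), ∀ T' ∈ insert (rt c c T₁) (𝒯.erase T₁), T ≠ T' →
      ((T₀.1 \ T.1) ∆ (T₀.1 \ T'.1)).card = 2 * m := by
  classical
  have hsub : ∀ X : CMF G c, ((T₀.1 \ T₁.1) ∆ (T₀.1 \ X.1)) ⊆ T₀.1 := fun X t ht => by
    rw [mem_symmDiff, mem_sdiff, mem_sdiff] at ht; tauto
  have key : ∀ T₂ ∈ 𝒯.erase T₁, ((T₀.1 \ (rt c c T₁).1) ∆ (T₀.1 \ T₂.1)).card = 2 * m := by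
    intro T₂ hT₂
    obtain ⟨hne, hT₂𝒯⟩ := mem_erase.mp hT₂
    rw [dev_compl c hcen T₀ T₁, sdiff_symmDiff_eq T₀.1 _ _ sdiff_subset sdiff_subset, card_sdiff_of_subset (hsub T₂), hn,
      hpair T₁ hT₁ T₂ hT₂𝒯 (Ne.symm hne)]
    omega
  intro T hT T' hT' hne
  rcases mem_insert.mp hT with rfl | hTe <;> rcases mem_insert.mp hT' with rfl | hT'e
  · exact absurd rfl hne
  · exact key T' hT'e
  · rw [symmDiff_comm]; exact key T hTe
  · exact hpair T (mem_of_mem_erase hTe) T' (mem_of_mem_erase hT'e) hne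

section Frame

variable (hc2 : c * c = 1) (hcen : ∀ x : G, x * c = c * x) (T₀ : CMF G c) (𝒯 : Finset (CMF G c))
variable (hbase : ∀ Q : G, rt c Q T₀ = T₀ ∨ rt c Q T₀ = rt c c T₀ ∨ ∃ T₁ ∈ 𝒯, rt c Q T₀ = T₁ ∨ rt c Q T₀ = rt c c T₁)
variable (m : ℕ) (hn : T₀.1.card = 4 * m) (hH : ∀ T₁ ∈ 𝒯, (T₀.1 \ T₁.1).card = 2 * m)
variable (hpair : ∀ T₁ ∈ 𝒯, ∀ T₂ ∈ 𝒯, T₁ ≠ T₂ → ((T₀.1 \ T₁.1) ∆ (T₀.1 \ T₂.1)).card = 2 * m)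
variable (T₁ : CMF G c) (hT₁ : T₁ ∈ 𝒯) (Q : G) (hQ : rt c Q T₀ = T₁) (hQQ : Q * Q = 1)
variable (hσH : ∀ t ∈ T₀.1, ∀ t' ∈ T₀.1, (t' = t * Q ∨ t' = c * (t * Q)) → (t ∈ T₀.1 \ T₁.1 ↔ t' ∈ T₀.1 \ T₁.1))
variable (L : Submodule ℤ (CMF G c →₀ ℤ)) (hLrt : ∀ (Q' : G) (y : CMF G c →₀ ℤ), y ∈ L → Finsupp.mapDomain (rt c Q') y ∈ L)
variable (hcover : ∀ Ψ : CMF G c, 2 ≤ bpot c T₀ Ψ → ∃ Q₂ s s' : G, bpot c T₀ Ψ = ddist (rt c Q₂ T₀) Ψ ∧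
    s ∈ (rt c Q₂ T₀).1 \ Ψ.1 ∧ s' ∈ (rt c Q₂ T₀).1 \ Ψ.1 ∧ s ≠ s' ∧
    gface c hc2 Ψ s s' ∈ L ∧
    ((∃ Q₁ t t' : G, bpot c T₀ Ψ = ddist (rt c Q₁ T₀) Ψ ∧ t ∈ (rt c Q₁ T₀).1 \ Ψ.1 ∧ t' ∈ (rt c Q₁ T₀).1 \ Ψ.1 ∧ t ≠ t' ∧
        (∀ Q' : G, ddist (rt c Q' T₀) (oflipCM c hc2 t Ψ) = bpot c T₀ (oflipCM c hc2 t Ψ) → rt c Q' T₀ = rt c Q₁ T₀) ∧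
        (∀ Q' : G, ddist (rt c Q' T₀) (oflipCM c hc2 t' Ψ) = bpot c T₀ (oflipCM c hc2 t' Ψ) → rt c Q' T₀ = rt c Q₁ T₀) ∧
        (∀ Q' : G, ddist (rt c Q' T₀) (oflipCM c hc2 t (oflipCM c hc2 t' Ψ)) = bpot c T₀ (oflipCM c hc2 t (oflipCM c hc2 t' Ψ)) →
          rt c Q' T₀ = rt c Q₁ T₀)) →
      (∀ Q' : G, ddist (rt c Q' T₀) (oflipCM c hc2 s Ψ) = bpot c T₀ (oflipCM c hc2 s Ψ) → rt c Q' T₀ = rt c Q₂ T₀) ∧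
      (∀ Q' : G, ddist (rt c Q' T₀) (oflipCM c hc2 s' Ψ) = bpot c T₀ (oflipCM c hc2 s' Ψ) → rt c Q' T₀ = rt c Q₂ T₀) ∧
      (∀ Q' : G, ddist (rt c Q' T₀) (oflipCM c hc2 s (oflipCM c hc2 s' Ψ)) = bpot c T₀ (oflipCM c hc2 s (oflipCM c hc2 s' Ψ)) →
        rt c Q' T₀ = rt c Q₂ T₀)))
variable (hties : ∀ T : Finset G, T ⊆ T₀.1 \ T₁.1 → T.card = m →
    (∀ t ∈ T₀.1 \ T₁.1, ∀ t' ∈ T₀.1, (t' = t * Q ∨ t' = c * (t * Q)) → (t ∈ T ↔ t' ∉ T)) →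
    ∀ X : CMF G c, T₀.1 \ X.1 = T → ∀ Q' : G, ddist (rt c Q' T₀) X = m → rt c Q' T₀ = T₀ ∨ rt c Q' T₀ = T₁)
variable (htiesC : ∀ T' : Finset G, T' ⊆ T₀.1 ∩ T₁.1 → T'.card = m →
    (∀ t ∈ T₀.1 ∩ T₁.1, ∀ t' ∈ T₀.1, (t' = t * Q ∨ t' = c * (t * Q)) → (t ∈ T' ↔ t' ∉ T')) →
    ∀ X : CMF G c, T₀.1 \ X.1 = T' → ∀ Q' : G, ddist (rt c Q' T₀) X = m → rt c Q' T₀ = T₀ ∨ rt c Q' T₀ = rt c c T₁)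

/-! ## §1 Swapped transversals: `Y_s − Y_{σs}` -/

include hc2 hcen hbase hn hH hpair hT₁ hQ hQQ hσH hLrt hcover hties in
/-- **`Y_s − Y_{σs} ∈ L` in a multi-partner block** (the multi-partner form of part VIIʼs `Y_sub_Y_mem`, stated for the `Y`-classes
`Y_x = (f_x − e₀) + (g_x − e₁)` of part XLIX): for a transversal `T ⊆ 𝓗` of the dihedral-type swap with `|T| = m ≥ 2`, `s ∈ T` and `s'` the representative
of the place of `s·Q`: `Y_s − Y_{s'} ∈ L`. [folklore] -/
theorem Y_sub_Y_mem_partners (hm : 2 ≤ m) (T : Finset G) (hTH : T ⊆ T₀.1 \ T₁.1) (hTm : T.card = m)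
    (hT : ∀ t ∈ T₀.1 \ T₁.1, ∀ t' ∈ T₀.1, (t' = t * Q ∨ t' = c * (t * Q)) → (t ∈ T ↔ t' ∉ T))
    {s s' : G} (hs : s ∈ T) (hs'0 : s' ∈ T₀.1) (hss' : s' = s * Q ∨ s' = c * (s * Q)) :
    ((Finsupp.single (oflipCM c hc2 s T₀) (1 : ℤ) - Finsupp.single T₀ 1) + (Finsupp.single (oflipCM c hc2 s T₁) (1 : ℤ) - Finsupp.single T₁ 1)) -
      ((Finsupp.single (oflipCM c hc2 s' T₀) (1 : ℤ) - Finsupp.single T₀ 1) + (Finsupp.single (oflipCM c hc2 s' T₁) (1 : ℤ) - Finsupp.single T₁ 1))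
      ∈ L := by
  -- the `Y`-classes `Y_x = (f_x − e₀) + (g_x − e₁)` of part XLIX; `Y_s − Y_{s'} = (f_s + g_s) − (f_{s'} + g_{s'})`
  suffices h : (Finsupp.single (oflipCM c hc2 s T₀) (1 : ℤ) + Finsupp.single (oflipCM c hc2 s T₁) 1) -
      (Finsupp.single (oflipCM c hc2 s' T₀) (1 : ℤ) + Finsupp.single (oflipCM c hc2 s' T₁) 1) ∈ L by
    have e : ((Finsupp.single (oflipCM c hc2 s T₀) (1 : ℤ) - Finsupp.single T₀ 1) + (Finsupp.single (oflipCM c hc2 s T₁) (1 : ℤ) - Finsupp.single T₁ 1)) -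
        ((Finsupp.single (oflipCM c hc2 s' T₀) (1 : ℤ) - Finsupp.single T₀ 1) + (Finsupp.single (oflipCM c hc2 s' T₁) (1 : ℤ) - Finsupp.single T₁ 1)) =
        (Finsupp.single (oflipCM c hc2 s T₀) (1 : ℤ) + Finsupp.single (oflipCM c hc2 s T₁) 1) -
          (Finsupp.single (oflipCM c hc2 s' T₀) (1 : ℤ) + Finsupp.single (oflipCM c hc2 s' T₁) 1) := by abel
    rw [e]; exact h
  obtain ⟨hs'T, hs'H, hsub, hcard, hT'⟩ := transversal_swap c hc2 T₀ T₁ hQQ hσH T hTH hT hs hs'0 hss'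
  have hne : s ≠ s' := fun h => hs'T (h ▸ hs)
  have hsH : s ∈ T₀.1 \ T₁.1 := hTH hs
  have h1 := rel_transversal_mem_partners c hc2 hcen T₀ 𝒯 hbase m hn hH hpair T₁ hT₁ Q hQ hQQ L hLrt hcover hm hσH T hTH hTm hT
    (hties T hTH hTm hT)
  have h2 := rel_transversal_mem_partners c hc2 hcen T₀ 𝒯 hbase m hn hH hpair T₁ hT₁ Q hQ hQQ L hLrt hcover hm hσH _ hsub (hcard.trans hTm)
    hT' (hties _ hsub (hcard.trans hTm) hT')
  have hdiff := Submodule.sub_mem _ h1 h2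
  -- the sums over the two transversals
  have hs'e : s' ∉ T.erase s := fun h => hs'T (mem_of_mem_erase h)
  have hset : (T₀.1 \ T₁.1) \ insert s' (T.erase s) = insert s (((T₀.1 \ T₁.1) \ T).erase s') := by
    have h1 := mem_sdiff.mp hsH
    ext x
    simp only [mem_sdiff, mem_insert, mem_erase]
    by_cases hxs : x = s
    · subst hxs
      constructor
      · intro _; exact Or.inl rfl
      · intro _; exact ⟨h1, fun h => h.elim (fun e => hne e) (fun h' => h'.1 rfl)⟩
    · constructor
      · rintro ⟨hx, h⟩
        refine Or.inr ⟨fun e => h (Or.inl e), hx, fun hxT => h (Or.inr ⟨hxs, hxT⟩)⟩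
      · rintro (h | ⟨hxs', hx, hxT⟩)
        · exact absurd h hxs
        · exact ⟨hx, fun h => h.elim (fun e => hxs' e) (fun h' => hxT h'.2)⟩
  have hse : s ∉ ((T₀.1 \ T₁.1) \ T).erase s' := fun h => (mem_sdiff.mp (mem_of_mem_erase h)).2 hs
  have hs'D : s' ∈ (T₀.1 \ T₁.1) \ T := mem_sdiff.mpr ⟨hs'H, hs'T⟩
  rw [hset, sum_insert hs'e, sum_insert hse, ← add_sum_erase T _ hs, ← add_sum_erase _ _ hs'D] at hdiff
  have e : (Finsupp.single (oflipCM c hc2 s T₀) (1 : ℤ) + Finsupp.single (oflipCM c hc2 s T₁) 1) -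
      (Finsupp.single (oflipCM c hc2 s' T₀) (1 : ℤ) + Finsupp.single (oflipCM c hc2 s' T₁) 1) =
      (Finsupp.single (oflipCM c hc2 s T₀) (1 : ℤ) + ∑ x ∈ T.erase s, Finsupp.single (oflipCM c hc2 x T₀) (1 : ℤ) -
        (Finsupp.single (oflipCM c hc2 s' T₁) (1 : ℤ) + ∑ x ∈ ((T₀.1 \ T₁.1) \ T).erase s', Finsupp.single (oflipCM c hc2 x T₁) (1 : ℤ)) -
        ((m : ℤ) - 1) • (Finsupp.single T₀ (1 : ℤ) - Finsupp.single T₁ 1)) -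
      (Finsupp.single (oflipCM c hc2 s' T₀) (1 : ℤ) + ∑ x ∈ T.erase s, Finsupp.single (oflipCM c hc2 x T₀) (1 : ℤ) -
        (Finsupp.single (oflipCM c hc2 s T₁) (1 : ℤ) + ∑ x ∈ ((T₀.1 \ T₁.1) \ T).erase s', Finsupp.single (oflipCM c hc2 x T₁) (1 : ℤ)) -
        ((m : ℤ) - 1) • (Finsupp.single T₀ (1 : ℤ) - Finsupp.single T₁ 1)) := by abel
  rw [e]; exact hdiff

/-! ## §3 The companion frame: `Rᶜ(T')` and `Y'_a − Y'_{σa}` -/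

include hcen hbase hn hH hpair hT₁ hQ hQQ hσH hLrt hcover htiesC in
/-- **`Rᶜ(T') ∈ L` in a multi-partner block** (`m ≥ 2`, all pairs in `L`; the multi-partner form of part VIIʼs `relc_mem`, packaged as the hypothesis
`hRc` of part XLIXʼs `residual_closure_partners_pow`): if `T₀ ∩ T₁` has a transversal `T'` of the place permutation with `|T'| = m`, then for such a `T'`
`Σ_{s∈T'} f_s + Σ_{u ∈ (T₀∩T₁)∖T'} g_u − (m−1)·(e₀ + e₁) ∈ L` — part LI in the companion frame `(T₀; T̄₁, cQ)`, whose partners are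
`insert T̄₁ (𝒯.erase T₁)`, modulo pairs. [folklore] -/
theorem relc_mem_partners (hP : ∀ Ψ : CMF G c, pair c Ψ ∈ L) (hm : 2 ≤ m)
    (hex : ∃ T' : Finset G, T' ⊆ T₀.1 ∩ T₁.1 ∧ T'.card = m ∧
      ∀ t ∈ T₀.1 ∩ T₁.1, ∀ t' ∈ T₀.1, (t' = t * Q ∨ t' = c * (t * Q)) → (t ∈ T' ↔ t' ∉ T')) :
    ∃ T' : Finset G, T' ⊆ T₀.1 ∩ T₁.1 ∧ T'.card = m ∧
      ∑ s ∈ T', Finsupp.single (oflipCM c hc2 s T₀) (1 : ℤ) + ∑ u ∈ (T₀.1 ∩ T₁.1) \ T', Finsupp.single (oflipCM c hc2 u T₁) (1 : ℤ) -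
        ((m : ℤ) - 1) • (Finsupp.single T₀ (1 : ℤ) + Finsupp.single T₁ 1) ∈ L := by
  classical
  obtain ⟨T', hTH, hTm, hT⟩ := hex
  refine ⟨T', hTH, hTm, ?_⟩
  have hHc : T₀.1 \ (rt c c T₁).1 = T₀.1 ∩ T₁.1 := by
    rw [dev_compl c hcen T₀ T₁]; ext t; simp only [mem_sdiff, mem_inter, not_and, not_not]; tauto
  have hT2 : ∀ t ∈ T₀.1 \ (rt c c T₁).1, ∀ t' ∈ T₀.1, (t' = t * (c * Q) ∨ t' = c * (t * (c * Q))) → (t ∈ T' ↔ t' ∉ T') := by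
    intro t ht t' ht' h
    rw [or_companion_iff c hc2 hcen Q] at h
    rw [hHc] at ht
    exact hT t ht t' ht' h
  have htie' : ∀ X : CMF G c, T₀.1 \ X.1 = T' → ∀ Q' : G, ddist (rt c Q' T₀) X = m → rt c Q' T₀ = T₀ ∨ rt c Q' T₀ = rt c c T₁ :=
    htiesC T' hTH hTm hT
  have h := rel_transversal_mem_partners c hc2 hcen T₀ (insert (rt c c T₁) (𝒯.erase T₁)) (companion_base_partners c hc2 hbase) m hn
    (companion_card_partners c hcen T₀ 𝒯 m hn hH hT₁) (companion_pair_partners c hcen T₀ 𝒯 m hn hpair hT₁) (rt c c T₁) (mem_insert_self _ _)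
    (c * Q) (companion_rt c T₀ T₁ Q hQ) (companion_sq c hc2 hcen Q hQQ) L hLrt hcover hm (companion_swap c hc2 hcen T₀ T₁ Q hσH)
    T' (by rw [hHc]; exact hTH) hTm hT2 htie'
  rw [hHc] at h
  have hsr : ∀ X : CMF G c, Finsupp.single (rt c c X) (1 : ℤ) = pair c X - Finsupp.single X 1 := fun X => by
    rw [pair, add_sub_cancel_left]
  simp only [oflipCM_rt_self c hc2 hcen, hsr] at h
  have hp1 : ∑ u ∈ (T₀.1 ∩ T₁.1) \ T', pair c (oflipCM c hc2 u T₁) ∈ L := Submodule.sum_mem _ fun u _ => hP _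
  have hp2 : ((m : ℤ) - 1) • pair c T₁ ∈ L := Submodule.smul_mem _ _ (hP T₁)
  have hsum : ∑ u ∈ (T₀.1 ∩ T₁.1) \ T', (pair c (oflipCM c hc2 u T₁) - Finsupp.single (oflipCM c hc2 u T₁) (1 : ℤ)) =
      ∑ u ∈ (T₀.1 ∩ T₁.1) \ T', pair c (oflipCM c hc2 u T₁) - ∑ u ∈ (T₀.1 ∩ T₁.1) \ T', Finsupp.single (oflipCM c hc2 u T₁) (1 : ℤ) :=
    sum_sub_distrib _ _
  rw [hsum] at h
  have e : ∑ s ∈ T', Finsupp.single (oflipCM c hc2 s T₀) (1 : ℤ) + ∑ u ∈ (T₀.1 ∩ T₁.1) \ T', Finsupp.single (oflipCM c hc2 u T₁) (1 : ℤ) -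
      ((m : ℤ) - 1) • (Finsupp.single T₀ (1 : ℤ) + Finsupp.single T₁ 1) =
      (∑ s ∈ T', Finsupp.single (oflipCM c hc2 s T₀) (1 : ℤ) -
        (∑ u ∈ (T₀.1 ∩ T₁.1) \ T', pair c (oflipCM c hc2 u T₁) - ∑ u ∈ (T₀.1 ∩ T₁.1) \ T', Finsupp.single (oflipCM c hc2 u T₁) (1 : ℤ)) -
        ((m : ℤ) - 1) • (Finsupp.single T₀ (1 : ℤ) - (pair c T₁ - Finsupp.single T₁ 1))) +
      ∑ u ∈ (T₀.1 ∩ T₁.1) \ T', pair c (oflipCM c hc2 u T₁) - ((m : ℤ) - 1) • pair c T₁ := by module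
  rw [e]
  exact Submodule.sub_mem _ (Submodule.add_mem _ h hp1) hp2

include hc2 hcen hbase hn hH hpair hT₁ hQ hQQ hσH hLrt hcover htiesC in
/-- **`Y'_a − Y'_{σa} ∈ L` in a multi-partner block** (`m ≥ 2`, pairs in `L`; the multi-partner form of part VIIʼs `Y'_sub_Y'_mem`, stated for the
`Y'`-classes `Y'_x = (f_x − e₀) − (g_x − e₁)` of part XLIX): for a transversal `T' ⊆ T₀ ∩ T₁` of size `m` containing `a`, with `a'` the representative of the
place of `a·Q`: `Y'_a − Y'_{a'} ∈ L` — §1 in the companion frame, modulo pairs. [folklore] -/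
theorem Y'_sub_Y'_mem_partners (hP : ∀ Ψ : CMF G c, pair c Ψ ∈ L) (hm : 2 ≤ m) (T' : Finset G) (hTH : T' ⊆ T₀.1 ∩ T₁.1)
    (hTm : T'.card = m) (hT : ∀ t ∈ T₀.1 ∩ T₁.1, ∀ t' ∈ T₀.1, (t' = t * Q ∨ t' = c * (t * Q)) → (t ∈ T' ↔ t' ∉ T'))
    {a a' : G} (ha : a ∈ T') (ha'0 : a' ∈ T₀.1) (haa' : a' = a * Q ∨ a' = c * (a * Q)) :
    ((Finsupp.single (oflipCM c hc2 a T₀) (1 : ℤ) - Finsupp.single T₀ 1) - (Finsupp.single (oflipCM c hc2 a T₁) (1 : ℤ) - Finsupp.single T₁ 1)) -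
      ((Finsupp.single (oflipCM c hc2 a' T₀) (1 : ℤ) - Finsupp.single T₀ 1) - (Finsupp.single (oflipCM c hc2 a' T₁) (1 : ℤ) - Finsupp.single T₁ 1))
      ∈ L := by
  classical
  -- the `Y'`-classes `Y'_x = (f_x − e₀) − (g_x − e₁)` of part XLIX; `Y'_a − Y'_{a'} = (f_a − g_a) − (f_{a'} − g_{a'})`
  suffices h : (Finsupp.single (oflipCM c hc2 a T₀) (1 : ℤ) - Finsupp.single (oflipCM c hc2 a T₁) 1) -
      (Finsupp.single (oflipCM c hc2 a' T₀) (1 : ℤ) - Finsupp.single (oflipCM c hc2 a' T₁) 1) ∈ L by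
    have e : ((Finsupp.single (oflipCM c hc2 a T₀) (1 : ℤ) - Finsupp.single T₀ 1) - (Finsupp.single (oflipCM c hc2 a T₁) (1 : ℤ) - Finsupp.single T₁ 1)) -
        ((Finsupp.single (oflipCM c hc2 a' T₀) (1 : ℤ) - Finsupp.single T₀ 1) - (Finsupp.single (oflipCM c hc2 a' T₁) (1 : ℤ) - Finsupp.single T₁ 1)) =
        (Finsupp.single (oflipCM c hc2 a T₀) (1 : ℤ) - Finsupp.single (oflipCM c hc2 a T₁) 1) -
          (Finsupp.single (oflipCM c hc2 a' T₀) (1 : ℤ) - Finsupp.single (oflipCM c hc2 a' T₁) 1) := by abel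
    rw [e]; exact h
  have hHc : T₀.1 \ (rt c c T₁).1 = T₀.1 ∩ T₁.1 := by
    rw [dev_compl c hcen T₀ T₁]; ext t; simp only [mem_sdiff, mem_inter, not_and, not_not]; tauto
  have hties' : ∀ T : Finset G, T ⊆ T₀.1 \ (rt c c T₁).1 → T.card = m →
      (∀ t ∈ T₀.1 \ (rt c c T₁).1, ∀ t' ∈ T₀.1, (t' = t * (c * Q) ∨ t' = c * (t * (c * Q))) → (t ∈ T ↔ t' ∉ T)) →
      ∀ X : CMF G c, T₀.1 \ X.1 = T → ∀ Q' : G, ddist (rt c Q' T₀) X = m → rt c Q' T₀ = T₀ ∨ rt c Q' T₀ = rt c c T₁ := by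
    intro T hTH' hTm' hT'
    rw [hHc] at hTH'
    refine htiesC T hTH' hTm' fun t ht t' ht' h => ?_
    exact hT' t (by rw [hHc]; exact ht) t' ht' ((or_companion_iff c hc2 hcen Q t t').mpr h)
  have hT2 : ∀ t ∈ T₀.1 \ (rt c c T₁).1, ∀ t' ∈ T₀.1, (t' = t * (c * Q) ∨ t' = c * (t * (c * Q))) → (t ∈ T' ↔ t' ∉ T') := by
    intro t ht t' ht' h
    rw [or_companion_iff c hc2 hcen Q] at h
    rw [hHc] at ht
    exact hT t ht t' ht' h
  have h := Y_sub_Y_mem_partners c hc2 hcen T₀ (insert (rt c c T₁) (𝒯.erase T₁)) (companion_base_partners c hc2 hbase) m hn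
    (companion_card_partners c hcen T₀ 𝒯 m hn hH hT₁) (companion_pair_partners c hcen T₀ 𝒯 m hn hpair hT₁) (rt c c T₁) (mem_insert_self _ _)
    (c * Q) (companion_rt c T₀ T₁ Q hQ) (companion_sq c hc2 hcen Q hQQ) (companion_swap c hc2 hcen T₀ T₁ Q hσH) L hLrt hcover hties' hm
    T' (by rw [hHc]; exact hTH) hTm hT2 ha ha'0 ((or_companion_iff c hc2 hcen Q a a').mpr haa')
  have hsr : ∀ X : CMF G c, Finsupp.single (rt c c X) (1 : ℤ) = pair c X - Finsupp.single X 1 := fun X => by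
    rw [pair, add_sub_cancel_left]
  simp only [oflipCM_rt_self c hc2 hcen, hsr] at h
  have hp : pair c (oflipCM c hc2 a' T₁) - pair c (oflipCM c hc2 a T₁) ∈ L := Submodule.sub_mem _ (hP _) (hP _)
  have e : (Finsupp.single (oflipCM c hc2 a T₀) (1 : ℤ) - Finsupp.single (oflipCM c hc2 a T₁) 1) -
      (Finsupp.single (oflipCM c hc2 a' T₀) (1 : ℤ) - Finsupp.single (oflipCM c hc2 a' T₁) 1) =
      ((((Finsupp.single (oflipCM c hc2 a T₀) (1 : ℤ) - Finsupp.single T₀ 1) +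
          ((pair c (oflipCM c hc2 a T₁) - Finsupp.single (oflipCM c hc2 a T₁) 1) - (pair c T₁ - Finsupp.single T₁ 1))) -
        ((Finsupp.single (oflipCM c hc2 a' T₀) (1 : ℤ) - Finsupp.single T₀ 1) +
          ((pair c (oflipCM c hc2 a' T₁) - Finsupp.single (oflipCM c hc2 a' T₁) 1) - (pair c T₁ - Finsupp.single T₁ 1)))) +
      (pair c (oflipCM c hc2 a' T₁) - pair c (oflipCM c hc2 a T₁))) := by module
  rw [e]
  exact Submodule.add_mem _ h hp

end Frame

end

end Summit.HodgeConjecture.CorCM.Census.CentralSquares
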